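import Summits.HubbardSuperconductivity.HubbardSuperconductivity.Theorems.AnisotropyChordTransferFibre3Hole2L9
import Summits.HubbardSuperconductivity.HubbardSuperconductivity.Theorems.AnisotropyChordTransferFibre3Hole2L10
import Summits.HubbardSuperconductivity.HubbardSuperconductivity.Theorems.AnisotropyChordTransferFibre3Hole2L11
import Summits.HubbardSuperconductivity.HubbardSuperconductivity.Theorems.AnisotropyChordTransferFibre3Hole2L12
import Summits.HubbardSuperconductivity.HubbardSuperconductivity.Theorems.AnisotropyChordTransferFibre3Hole2L13
import Summits.HubbardSuperconductivity.HubbardSuperconductivity.Theorems.AnisotropyChordTransferFibre3Hole2L14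
import Summits.HubbardSuperconductivity.HubbardSuperconductivity.Theorems.AnisotropyChordTransferFibre3Hole2L15
import Summits.HubbardSuperconductivity.HubbardSuperconductivity.Theorems.AnisotropyChordTransferFibre3Hole2L16
import Summits.HubbardSuperconductivity.HubbardSuperconductivity.Theorems.AnisotropyChordTransferFibre3Hole2L17
import Summits.HubbardSuperconductivity.HubbardSuperconductivity.Theorems.AnisotropyChordTransferFibre3Hole2L18
import Summits.HubbardSuperconductivity.HubbardSuperconductivity.Theorems.AnisotropyChordTransferFibre3Hole2L19
import Summits.HubbardSuperconductivity.HubbardSuperconductivity.Theorems.AnisotropyChordTransferFibre3Hole2L20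
import Summits.HubbardSuperconductivity.HubbardSuperconductivity.Theorems.AnisotropyChordTransferFibre3Hole2L21
import Summits.HubbardSuperconductivity.HubbardSuperconductivity.Theorems.AnisotropyChordTransferFibre3Hole2L22
import Summits.HubbardSuperconductivity.HubbardSuperconductivity.Theorems.AnisotropyChordTransferFibre3Hole2L23
import Summits.HubbardSuperconductivity.HubbardSuperconductivity.Theorems.AnisotropyChordTransferFibre3Hole2L24
import Summits.HubbardSuperconductivity.HubbardSuperconductivity.Theorems.AnisotropyChordTransferFibre3Hole2L25
import Summits.HubbardSuperconductivity.HubbardSuperconductivity.Theorems.AnisotropyChordTransferFibre3Hole2L26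
import Summits.HubbardSuperconductivity.HubbardSuperconductivity.Theorems.AnisotropyChordTransferFibre3Hole2L27
import Summits.HubbardSuperconductivity.HubbardSuperconductivity.Theorems.AnisotropyChordTransferFibre3Hole2L28
import Summits.HubbardSuperconductivity.HubbardSuperconductivity.Theorems.AnisotropyChordTransferFibre3Hole2L29
import Summits.HubbardSuperconductivity.HubbardSuperconductivity.Theorems.AnisotropyChordTransferFibre3Hole2L30
import Summits.HubbardSuperconductivity.HubbardSuperconductivity.Theorems.AnisotropyChordTransferFibre3Hole2L31
import Summits.HubbardSuperconductivity.HubbardSuperconductivity.Theorems.AnisotropyChordTransferFibre3Hole2L32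

/-!
# Route `AnisotropyChord` / H0 rotor rung: ★★★ HOLE₂(.75) ON THE WHOLE FIN RANGE — `TwoHoleGap L (3/4·eps1 L)` for every `9 ≤ L ≤ 32`

Capstone of the per-`L` kernel certificates `…Fibre3Hole2L9` … `…Fibre3Hole2L32`: the one one-body spectral hypothesis of the GM₃
assembly `gm3_of_hole2` (p1 g23, `…Fibre3AssemblyHole2`) — the Neumann gap of the rate-½ walk on the twice-punctured `L × L` torus is
at least `¾ε₁(L)` for EVERY pair of deleted vertices — holds for every side length of the FIN range `9 ≤ L ≤ 32` of the theory seat's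
∀L plan (LEVEL2-SPEC §4; `L = 8` is excluded: HOLE₂(.75) is false there, p1's `not_twoHoleGap_eight`; `L ≥ 32` is the analytic
regime).  Each instance is a zero-data kernel certificate (interval Birman–Schwinger test `Hole2.checkRepsQ` / `checkPairWith`,
`decide +kernel`) composed with the soundness chain `…Hole2Check/Interval/Green/Sound/Agg/Cert/Fast/FastSound/Quarter` (p2's PROP BS,
p1's reductions); this file is `interval_cases`.
Prover seat `hubbard-h0-rotor-p3` g3; helper for stmt-HubbardSuperconductivity-19089 (`--supports`, helper class).
WHAT THIS IS NOT: nothing here proves superconductivity in the Hubbard model (rotor TARGET as worded stays FALSE, g15 verdict); it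
discharges ONE hypothesis (HOLE₂(.75)) of ONE conditional reduction (rung 19089) on a finite range of `L`; the three β-free cruxes,
`mHole ≥ 0` and the side condition of `gm3_of_hole2` are untouched. Tree imports only; no sorry, no axioms.
-/

set_option linter.dupNamespace false
set_option autoImplicit false

namespace Summit.HubbardSuperconductivity.HubbardSuperconductivity.Theorems.AnisotropyChord.Transfer.Fibre3

namespace Hole2

/-- ★★★ HOLE₂(.75) for every `9 ≤ L ≤ 32`: `TwoHoleGap L (3/4 * eps1 L)`. [folklore] -/
theorem twoHoleGap_finRange (L : ℕ) [NeZero L] (h9 : 9 ≤ L) (h32 : L ≤ 32) : TwoHoleGap L (3 / 4 * eps1 L) := by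
  interval_cases L
  · exact twoHoleGap_nine
  · exact twoHoleGap_ten
  · exact twoHoleGap_eleven
  · exact twoHoleGap_twelve
  · exact twoHoleGap_thirteen
  · exact twoHoleGap_fourteen
  · exact twoHoleGap_fifteen
  · exact twoHoleGap_sixteen
  · exact twoHoleGap_seventeen
  · exact twoHoleGap_eighteen
  · exact twoHoleGap_nineteen
  · exact twoHoleGap_twenty
  · exact twoHoleGap_twentyOne
  · exact twoHoleGap_twentyTwo
  · exact twoHoleGap_twentyThree
  · exact twoHoleGap_twentyFour
  · exact twoHoleGap_twentyFive
  · exact twoHoleGap_twentySix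
  · exact twoHoleGap_twentySeven
  · exact twoHoleGap_twentyEight
  · exact twoHoleGap_twentyNine
  · exact twoHoleGap_thirty
  · exact twoHoleGap_thirtyOne
  · exact twoHoleGap_thirtyTwo

end Hole2

end Summit.HubbardSuperconductivity.HubbardSuperconductivity.Theorems.AnisotropyChord.Transfer.Fibre3
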